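import Mathlib

/-!
# The '1 or 6' law: algebraic skeleton of THEOREM E′ (§7.11 (16.12), session 25)

Universality (16.12)(b) shows that at a LINEAR `p = 5` cell field with `m = r⁻ = 1` the
Massey-type quantity `R(η, u) = ⟨δ_η z_u, c′⟩` of THEOREM E (E2) is, for fixed `u`, a binary
quadratic form in the coordinates `(x, y)` of `η ∈ U_F/5`, linear in `u`, and that
`R(η, η) = 0` for every `η` (canonical class).  Writing `R(η, u) = u₁·B₁(η) + u₂·B₂(η)` the
hypothesis says that the binary cubic `x·B₁(x,y) + y·B₂(x,y)` vanishes identically; the purely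
algebraic consequence, proved here over any field of characteristic `≠ 2`, is
`B₁ = y·M`, `B₂ = -x·M` for a LINEAR form `M`, i.e. `R(η, u) = M(η)·det(u, η)`
(`soloInformed_massey_factorisation`).  Hence the conic classes sit at the zeros of a linear
form on `ℙ¹(𝔽₅)`: exactly one line or all six (`soloInformed_linearForm_zerosP1_five`).
For the `p = 7`, `k = 3` refinement ((16.12)(d)) the analogous inputs are: a binary quartic
vanishing at five points of `ℙ¹` is zero (`soloInformed_binaryQuartic_eq_zero`, char `≠ 2, 3`),
and a binary quadratic form over `𝔽₇` has `0, 1, 2` or `8` zeros on `ℙ¹(𝔽₇)`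
(`soloInformed_quadForm_zerosP1_seven`).

These are kernel facts about forms over (finite) fields; the cohomological input (naturality
of connecting maps along `Sym^k 𝒱_η ⊂ Sym^k 𝒱` for the Kummer tangent module `𝒱`) is the
paper-level part of THEOREM E′ and is not formalised here.
-/

namespace Summit.Langlands.Langlands.Theorems

/-- A binary cubic form over a field of characteristic `≠ 2` vanishing at the four points
`(1,0), (0,1), (1,1), (1,-1)` of `ℙ¹` is zero. -/
theorem soloInformed_binaryCubic_eq_zero {K : Type*} [Field K] (h2 : (2 : K) ≠ 0)
    (a b c d : K)
    (h : ∀ x y : K, a * x ^ 3 + b * x ^ 2 * y + c * x * y ^ 2 + d * y ^ 3 = 0) :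
    a = 0 ∧ b = 0 ∧ c = 0 ∧ d = 0 := by
  have h10 := h 1 0
  have h01 := h 0 1
  have h11 := h 1 1
  have h1m := h 1 (-1)
  have ha : a = 0 := by linear_combination h10
  have hd : d = 0 := by linear_combination h01
  have h2c : 2 * c = 0 := by linear_combination h11 + h1m - 2 * ha
  have hc : c = 0 := by
    rcases mul_eq_zero.mp h2c with h' | h'
    · exact absurd h' h2
    · exact h'
  have hb : b = 0 := by linear_combination h11 - ha - hc - hd
  exact ⟨ha, hb, hc, hd⟩

/-- A binary quartic form over a field with `2 ≠ 0`, `3 ≠ 0` vanishing at the five points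
`(1,0), (0,1), (1,1), (1,-1), (1,2)` of `ℙ¹` is zero (used at `p = 7`, `k = 3`). -/
theorem soloInformed_binaryQuartic_eq_zero {K : Type*} [Field K] (h2 : (2 : K) ≠ 0)
    (h3 : (3 : K) ≠ 0) (a b c d e : K)
    (h : ∀ x y : K,
      a * x ^ 4 + b * x ^ 3 * y + c * x ^ 2 * y ^ 2 + d * x * y ^ 3 + e * y ^ 4 = 0) :
    a = 0 ∧ b = 0 ∧ c = 0 ∧ d = 0 ∧ e = 0 := by
  have h10 := h 1 0
  have h01 := h 0 1
  have h11 := h 1 1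
  have h1m := h 1 (-1)
  have h12 := h 1 2
  have ha : a = 0 := by linear_combination h10
  have he : e = 0 := by linear_combination h01
  have h2c : 2 * c = 0 := by linear_combination h11 + h1m - 2 * ha - 2 * he
  have hc : c = 0 := by
    rcases mul_eq_zero.mp h2c with h' | h'
    · exact absurd h' h2
    · exact h'
  have hbd : b + d = 0 := by linear_combination h11 - ha - hc - he
  -- at (1,2): a + 2b + 4c + 8d + 16e = 0, i.e. 2b + 8d = 0, with b = -d: 6d = 0
  have h6d : 2 * (3 * d) = 0 := by linear_combination h12 - ha - 4 * hc - 16 * he - 2 * hbd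
  have hd : d = 0 := by
    rcases mul_eq_zero.mp h6d with h' | h'
    · exact absurd h' h2
    · rcases mul_eq_zero.mp h' with h'' | h''
      · exact absurd h'' h3
      · exact h''
  have hb : b = 0 := by linear_combination hbd - hd
  exact ⟨ha, hb, hc, hd, he⟩

/-- THEOREM E′, algebraic part.  If two binary quadratic forms
`B₁ = a x² + b xy + c y²`, `B₂ = d x² + e xy + f y²` over a field of characteristic `≠ 2`
satisfy `x·B₁(x,y) + y·B₂(x,y) = 0` identically (this is `R(η, η) = 0`), then
`a = f = 0`, `d = -b`, `e = -c`. -/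
theorem soloInformed_massey_coefficients {K : Type*} [Field K] (h2 : (2 : K) ≠ 0)
    (a b c d e f : K)
    (h : ∀ x y : K,
      x * (a * x ^ 2 + b * x * y + c * y ^ 2) + y * (d * x ^ 2 + e * x * y + f * y ^ 2) = 0) :
    a = 0 ∧ f = 0 ∧ d = -b ∧ e = -c := by
  have h' : ∀ x y : K,
      a * x ^ 3 + (b + d) * x ^ 2 * y + (c + e) * x * y ^ 2 + f * y ^ 3 = 0 := by
    intro x y; linear_combination h x y
  obtain ⟨ha, hbd, hce, hf⟩ := soloInformed_binaryCubic_eq_zero h2 a (b + d) (c + e) f h'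
  exact ⟨ha, hf, by linear_combination hbd, by linear_combination hce⟩

/-- THEOREM E′, the factorisation `R(η, u) = M(η) · det(u, η)`: with `η = (x, y)`,
`u = (u₁, u₂)` and `R(η, u) = u₁·B₁(η) + u₂·B₂(η)`, the linear form is `M = b x + c y` and
`det(u, η) = u₁ y - u₂ x`. -/
theorem soloInformed_massey_factorisation {K : Type*} [Field K] (h2 : (2 : K) ≠ 0)
    (a b c d e f : K)
    (h : ∀ x y : K,
      x * (a * x ^ 2 + b * x * y + c * y ^ 2) + y * (d * x ^ 2 + e * x * y + f * y ^ 2) = 0)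
    (x y u₁ u₂ : K) :
    u₁ * (a * x ^ 2 + b * x * y + c * y ^ 2) + u₂ * (d * x ^ 2 + e * x * y + f * y ^ 2)
      = (b * x + c * y) * (u₁ * y - u₂ * x) := by
  obtain ⟨ha, hf, hd, he⟩ := soloInformed_massey_coefficients h2 a b c d e f h
  subst ha hf hd he
  ring

/-- Number of zeros on `ℙ¹(𝔽_p)` of a binary form given as a function `F(x, y)`:
the points are `(1 : y)` for `y ∈ 𝔽_p` and `(0 : 1)`. -/
def p1Zeros (p : ℕ) [NeZero p] (F : ZMod p → ZMod p → ZMod p) : ℕ :=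
  (Finset.univ.filter fun y : ZMod p => F 1 y = 0).card + (if F 0 1 = 0 then 1 else 0)

/-- '1 OR 6': a linear form `b x + c y` over `𝔽₅` vanishes at exactly one point of `ℙ¹(𝔽₅)`,
or (iff `b = c = 0`) at all six. -/
theorem soloInformed_linearForm_zerosP1_five (b c : ZMod 5) :
    (p1Zeros 5 (fun x y => b * x + c * y) = 1 ∧ (b ≠ 0 ∨ c ≠ 0)) ∨
    (p1Zeros 5 (fun x y => b * x + c * y) = 6 ∧ b = 0 ∧ c = 0) := by
  revert b c; decide

/-- The same over `𝔽₇` (eight points): `1` or `8`. -/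
theorem soloInformed_linearForm_zerosP1_seven (b c : ZMod 7) :
    p1Zeros 7 (fun x y => b * x + c * y) = 1 ∨
    (p1Zeros 7 (fun x y => b * x + c * y) = 8 ∧ b = 0 ∧ c = 0) := by
  revert b c; decide

/-- `p = 7`, `k = 3`: a binary quadratic form over `𝔽₇` has `0, 1, 2` or (iff it is zero) `8`
zeros on `ℙ¹(𝔽₇)` — the possible numbers of Kummer lines carrying a cubic class when all three
unit forms vanish ((16.12)(d)(S2)). -/
theorem soloInformed_quadForm_zerosP1_seven (a b c : ZMod 7) :
    p1Zeros 7 (fun x y => a * x ^ 2 + b * x * y + c * y ^ 2) ∈ ({0, 1, 2, 8} : Finset ℕ) := by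
  revert a b c; decide

end Summit.Langlands.Langlands.Theorems
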